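import Literature.NumberTheory.Rogawski1990.ArchSingularOrbitalIntegralProductPlaces   -- ★ p841332 (R1-c): the end state is a class orbital integral
import HarnessLib

/-!
# The end-state term of the «method of §8.2» as a multiple of a class orbital integral: products of scaled, pushed-forward wall measures ((R1-h-c) PRODUCT)
(Rogawski (1990) §8.2 pp. 122–124, §14.5 p. 238; Folland (1995) §2.6; Deitmar–Echterhoff (2014) Thm. 1.5.3)

Topic `NumberTheory/Rogawski1990`; namespaces `Literature.MeasureTheory.Group` (§1, generic) and `Literature.NumberTheory.Automorphic.UnitaryGroup` (§2, the binder telescope of ★ (R1-c)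
p841332 VERBATIM).  THEOREMS ONLY (no definition, no instance, no notation, no named fact, no `sorry`).  Cell `hodgecm-mathlib`, crux H413 (`stmt-HodgeConjecture-24833`); LEAD
F0P3a-plan (g9) WORD T8-104 (2) ((R1-h) «END-STATE SIGNED REGROUPING», sub-brick (R1-h-c) of F0P3a-p07 (g7)'s HANDOFF :33); F0P3-p03 (g9).  Count-neutral floor-1 plumbing;
HC_CM is proved only modulo the printed citations until rung 0 closes.

THE POINT.  After (R1-h-a)∕(R1-h-b) (★ `ArchWallOrbitMeasureTransport`) every wall measure at a place `w` reads `Wm_w = c_w • (dν_w∕dρ_w).map (ȳ ↦ y·diag(z_w)·y⁻¹)` with a scalar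
`c_w ∈ ℝ≥0` (`ρ_w(Z_w)` at a compact wall, `1` at a singular wall).  §1: the product of such measures is `(Π_w c_w) •` the image of the product of the quotient measures
(`Measure.pi` of `ℝ≥0`-multiples; Mathlib `Measure.pi_map_pi`), and integrals scale accordingly.  §2: combined with ★ (R1-c)
`integral_pi_quotientMeasure_comp_conj_circleDiagonal_eq_classOrbitalIntegral_archDiagTorus_of_atPoint_eq`, the end-state term `∫ f∘e⁻¹ d(⊗_w Wm_w)` of ★ p841698∕p841776 IS
`(Π_w c_w) · Φ(⟦t(z)⟧, f; m)` for every Weil-form family `m` matched at `t(z)` (`hq`).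

## References
* [Rogawski1990] J. D. Rogawski, *Automorphic Representations of Unitary Groups in Three Variables*, Ann. of Math. Stud. 123 (1990), §8.2 pp. 122–124, §14.5 p. 238.
* [Folland1995] G. B. Folland, *A Course in Abstract Harmonic Analysis* (1995), §2.6 (2.52).
* [DeitmarEchterhoff2014] A. Deitmar, S. Echterhoff, *Principles of Harmonic Analysis*, 2nd ed. (2014), Thm. 1.5.3.
-/

set_option autoImplicit false

noncomputable section

open MeasureTheory Measure Filter Topology
open scoped NNReal ENNReal

/-! ## §1 Generic: products of scaled and pushed-forward measures -/

namespace Literature.MeasureTheory.Group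

section PiSmul

variable {ι : Type*} [Fintype ι] {X : ι → Type*} [∀ i, MeasurableSpace (X i)]

/-- **`⊗_i (c_i • μ_i) = (Π_i c_i) • ⊗_i μ_i`** for `ℝ≥0` scalars and σ-finite measures (both sides agree on boxes; Mathlib `Measure.pi_eq`). [cite: Folland1995, §2.6] -/
theorem pi_nnreal_smul (μ : ∀ i, Measure (X i)) [∀ i, SigmaFinite (μ i)] (c : ι → ℝ≥0) :
    Measure.pi (fun i => c i • μ i) = (∏ i, c i) • Measure.pi μ := by
  refine Measure.pi_eq fun s _ => ?_
  simp only [Measure.coe_nnreal_smul_apply, Measure.pi_pi]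
  rw [Finset.prod_mul_distrib]
  push_cast
  rfl

/-- **`⊗_i (c_i • (μ_i).map f_i) = (Π_i c_i) • (⊗_i μ_i).map (x ↦ (f_i x_i)_i)`** (the previous lemma + Mathlib `Measure.pi_map_pi`). [cite: Folland1995, §2.6] -/
theorem pi_nnreal_smul_map {Y : ι → Type*} [∀ i, MeasurableSpace (Y i)] (μ : ∀ i, Measure (X i)) [∀ i, SigmaFinite (μ i)]
    (f : ∀ i, X i → Y i) (hf : ∀ i, Measurable (f i)) [∀ i, SigmaFinite ((μ i).map (f i))] (c : ι → ℝ≥0) :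
    Measure.pi (fun i => c i • (μ i).map (f i)) = (∏ i, c i) • (Measure.pi μ).map (fun x i => f i (x i)) := by
  rw [pi_nnreal_smul, Measure.pi_map_pi (fun i => (hf i).aemeasurable)]

/-- **Integrals against `⊗_i (c_i • (μ_i).map f_i)`**: `∫ F d(⊗_i (c_i • f_{i*} μ_i)) = (Π_i c_i) • ∫ F((f_i x_i)_i) d(⊗_i μ_i)`. [cite: Folland1995, §2.6] -/
theorem integral_pi_nnreal_smul_map {Y : ι → Type*} [∀ i, MeasurableSpace (Y i)] (μ : ∀ i, Measure (X i)) [∀ i, SigmaFinite (μ i)]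
    (f : ∀ i, X i → Y i) (hf : ∀ i, Measurable (f i)) [∀ i, SigmaFinite ((μ i).map (f i))] (c : ι → ℝ≥0)
    {E : Type*} [NormedAddCommGroup E] [NormedSpace ℝ E] (F : (∀ i, Y i) → E)
    (hF : AEStronglyMeasurable F ((Measure.pi μ).map (fun x i => f i (x i)))) :
    ∫ y, F y ∂(Measure.pi fun i => c i • (μ i).map (f i)) = ((∏ i, c i : ℝ≥0) : ℝ) • ∫ x, F (fun i => f i (x i)) ∂(Measure.pi μ) := by
  have hφ : Measurable (fun (x : ∀ i, X i) (i : ι) => f i (x i)) := measurable_pi_iff.2 fun i => (hf i).comp (measurable_pi_apply i)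
  rw [pi_nnreal_smul_map μ f hf c, integral_smul_nnreal_measure, integral_map hφ.aemeasurable hF, NNReal.smul_def]

end PiSmul

end Literature.MeasureTheory.Group

/-! ## §2 The end-state term is `(Π_w c_w) · Φ(⟦t(z)⟧, f; m)` -/

namespace Literature.NumberTheory.Automorphic.UnitaryGroup

open Literature.MeasureTheory.Group _root_.NumberField _root_.NumberField.InfinitePlace _root_.Matrix
open scoped Classical

variable (L : Type) [Field L] [NumberField L] [IsCMField L] (N : ℕ) (α : Fin N → L)

variable
  [MeasurableSpace (arch (↥(maximalRealSubfield L)) L (IsCMField.complexConj L) N (Matrix.diagonal α))]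
  [BorelSpace (arch (↥(maximalRealSubfield L)) L (IsCMField.complexConj L) N (Matrix.diagonal α))]
  [∀ γ' : arch (↥(maximalRealSubfield L)) L (IsCMField.complexConj L) N (Matrix.diagonal α),
    MeasurableSpace (arch (↥(maximalRealSubfield L)) L (IsCMField.complexConj L) N (Matrix.diagonal α) ⧸ Subgroup.centralizer ({γ'} : Set _))]
  [∀ γ' : arch (↥(maximalRealSubfield L)) L (IsCMField.complexConj L) N (Matrix.diagonal α),
    BorelSpace (arch (↥(maximalRealSubfield L)) L (IsCMField.complexConj L) N (Matrix.diagonal α) ⧸ Subgroup.centralizer ({γ'} : Set _))]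
  [∀ w : {w : InfinitePlace L // IsComplex w}, MeasurableSpace (archLocal L N (Matrix.diagonal α) w)]
  [∀ w : {w : InfinitePlace L // IsComplex w}, BorelSpace (archLocal L N (Matrix.diagonal α) w)]
  [∀ w : {w : InfinitePlace L // IsComplex w}, SecondCountableTopology (archLocal L N (Matrix.diagonal α) w)]
  [∀ w : {w : InfinitePlace L // IsComplex w}, LocallyCompactSpace (archLocal L N (Matrix.diagonal α) w)]
  (z : {w : InfinitePlace L // IsComplex w} → Fin N → Circle)
  [∀ w : {w : InfinitePlace L // IsComplex w}, MeasurableSpace (archLocal L N (Matrix.diagonal α) w ⧸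
    Subgroup.centralizer ({(⟨circleDiagonal N (z w), circleDiagonal_mem_archLocal_diagonal L N α w (z w)⟩ : archLocal L N (Matrix.diagonal α) w)} : Set _))]
  [∀ w : {w : InfinitePlace L // IsComplex w}, BorelSpace (archLocal L N (Matrix.diagonal α) w ⧸
    Subgroup.centralizer ({(⟨circleDiagonal N (z w), circleDiagonal_mem_archLocal_diagonal L N α w (z w)⟩ : archLocal L N (Matrix.diagonal α) w)} : Set _))]
  [MeasurableSpace ((∀ w : {w : InfinitePlace L // IsComplex w}, archLocal L N (Matrix.diagonal α) w) ⧸ Subgroup.pi Set.univ (fun w =>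
    Subgroup.centralizer ({(⟨circleDiagonal N (z w), circleDiagonal_mem_archLocal_diagonal L N α w (z w)⟩ : archLocal L N (Matrix.diagonal α) w)} : Set _)))]
  [BorelSpace ((∀ w : {w : InfinitePlace L // IsComplex w}, archLocal L N (Matrix.diagonal α) w) ⧸ Subgroup.pi Set.univ (fun w =>
    Subgroup.centralizer ({(⟨circleDiagonal N (z w), circleDiagonal_mem_archLocal_diagonal L N α w (z w)⟩ : archLocal L N (Matrix.diagonal α) w)} : Set _)))]
  (νw : ∀ w : {w : InfinitePlace L // IsComplex w}, Measure (archLocal L N (Matrix.diagonal α) w))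
  [∀ w, (νw w).IsHaarMeasure] [∀ w, (νw w).IsMulRightInvariant]
  (ρw : ∀ w : {w : InfinitePlace L // IsComplex w}, Measure (Subgroup.centralizer
    ({(⟨circleDiagonal N (z w), circleDiagonal_mem_archLocal_diagonal L N α w (z w)⟩ : archLocal L N (Matrix.diagonal α) w)} : Set _)))
  [∀ w, (ρw w).IsHaarMeasure] [∀ w, (ρw w).IsInvInvariant]
  (ρ : Measure (Subgroup.pi Set.univ (fun w : {w : InfinitePlace L // IsComplex w} => Subgroup.centralizer
    ({(⟨circleDiagonal N (z w), circleDiagonal_mem_archLocal_diagonal L N α w (z w)⟩ : archLocal L N (Matrix.diagonal α) w)} : Set _))))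
  [ρ.IsHaarMeasure] [ρ.IsInvInvariant]
  (hρ : Measure.map (subgroupPiCoords fun w : {w : InfinitePlace L // IsComplex w} => Subgroup.centralizer
    ({(⟨circleDiagonal N (z w), circleDiagonal_mem_archLocal_diagonal L N α w (z w)⟩ : archLocal L N (Matrix.diagonal α) w)} : Set _)) ρ = Measure.pi ρw)


include hρ in
/-- **(R1-h-c) THE END-STATE TERM IS A MULTIPLE OF THE CLASS ORBITAL INTEGRAL.**  With the binders of ★ (R1-c) (`ν = e⁻¹_*(⊗_w ν_w)`, `ρ′ = (e⁻¹|_{Π Z_w})_* ρ`, `ρ ↔ ⊗_w ρ_w`, a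
Weil-form family `m` matched at `t(z)` by `hq`) and per-place scalars `c_w ∈ ℝ≥0`: for Borel `f`,
`∫ f(e⁻¹ x) d(⊗_w [c_w • (dν_w∕dρ_w).map (ȳ ↦ y·diag(z_w)·y⁻¹)])(x) = (Π_w c_w) · Φ(⟦t(z)⟧, f; m)` — the end-state term `∫ Θ∘coe∘e⁻¹ d(⊗_w Wm_w(ρ))` of ★ p841698 once
each wall measure is read through ★ `ArchWallOrbitMeasureTransport` ((R1-h-a)∕(R1-h-b)). [cite: Rogawski1990, §8.2 pp. 122–124; §14.5 p. 238] [cite: Folland1995, §2.6 (2.52)]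
[cite: DeitmarEchterhoff2014, Thm. 1.5.3] -/
theorem integral_comp_archPiEquivCM_symm_pi_smul_map_descConj_eq_smul_classOrbitalIntegral
    [((Measure.pi νw).map (archPiEquivCM N L (Matrix.diagonal α)).symm).IsHaarMeasure]
    [((Measure.pi νw).map (archPiEquivCM N L (Matrix.diagonal α)).symm).IsMulRightInvariant]
    (m : OrbitalMeasureFamily (arch (↥(maximalRealSubfield L)) L (IsCMField.complexConj L) N (Matrix.diagonal α)))
    [SMulInvariantMeasure (arch (↥(maximalRealSubfield L)) L (IsCMField.complexConj L) N (Matrix.diagonal α))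
      (arch (↥(maximalRealSubfield L)) L (IsCMField.complexConj L) N (Matrix.diagonal α) ⧸
        Subgroup.centralizer ({(Quotient.out (ConjClasses.mk (archDiagTorus L N α z)) : arch (↥(maximalRealSubfield L)) L (IsCMField.complexConj L) N (Matrix.diagonal α))} : Set _))
      (m (ConjClasses.mk (archDiagTorus L N α z)))]
    (ρ' : Measure (Subgroup.centralizer ({archDiagTorus L N α z} : Set (arch (↥(maximalRealSubfield L)) L (IsCMField.complexConj L) N (Matrix.diagonal α)))))
    [ρ'.IsHaarMeasure] [ρ'.IsInvInvariant]
    (hρ' : ρ' = ρ.map (subgroupCongrHomeomorph (archPiEquivCM N L (Matrix.diagonal α)).symm.toMulEquiv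
      (Subgroup.pi Set.univ (fun w : {w : InfinitePlace L // IsComplex w} => Subgroup.centralizer
        ({(⟨circleDiagonal N (z w), circleDiagonal_mem_archLocal_diagonal L N α w (z w)⟩ : archLocal L N (Matrix.diagonal α) w)} : Set _)))
      (Subgroup.centralizer ({archDiagTorus L N α z} : Set _))
      (apply_mem_centralizer_iff_mem_pi_centralizer _ (archPiEquivCM N L (Matrix.diagonal α)).symm.toMulEquiv
        (archPiEquivCM_symm_circleDiagonal_eq_archDiagTorus L N α z))
      (archPiEquivCM N L (Matrix.diagonal α)).symm.continuous (archPiEquivCM N L (Matrix.diagonal α)).continuous))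
    (hq : m.atPoint (archDiagTorus L N α z) =
      quotientMeasure (Subgroup.centralizer ({archDiagTorus L N α z} : Set _)) ρ' (isClosed_coe_centralizer_singleton _)
        ((Measure.pi νw).map (archPiEquivCM N L (Matrix.diagonal α)).symm))
    [∀ w : {w : InfinitePlace L // IsComplex w}, SigmaFinite (quotientMeasure (Subgroup.centralizer
      ({(⟨circleDiagonal N (z w), circleDiagonal_mem_archLocal_diagonal L N α w (z w)⟩ : archLocal L N (Matrix.diagonal α) w)} : Set _)) (ρw w)
      (isClosed_coe_centralizer_singleton _) (νw w))]
    [∀ w : {w : InfinitePlace L // IsComplex w}, SigmaFinite ((quotientMeasure (Subgroup.centralizer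
      ({(⟨circleDiagonal N (z w), circleDiagonal_mem_archLocal_diagonal L N α w (z w)⟩ : archLocal L N (Matrix.diagonal α) w)} : Set _)) (ρw w)
      (isClosed_coe_centralizer_singleton _) (νw w)).map
      (descConj (⟨circleDiagonal N (z w), circleDiagonal_mem_archLocal_diagonal L N α w (z w)⟩ : archLocal L N (Matrix.diagonal α) w)
        (Subgroup.centralizer _) (fun _ hg => Subgroup.mem_centralizer_singleton_iff.1 hg) id))]
    (c : {w : InfinitePlace L // IsComplex w} → ℝ≥0)
    (f : arch (↥(maximalRealSubfield L)) L (IsCMField.complexConj L) N (Matrix.diagonal α) → ℂ) (hf : Measurable f) :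
    ∫ x, f ((archPiEquivCM N L (Matrix.diagonal α)).symm x)
        ∂(Measure.pi fun w => c w • (quotientMeasure (Subgroup.centralizer _) (ρw w) (isClosed_coe_centralizer_singleton _) (νw w)).map
          (descConj (⟨circleDiagonal N (z w), circleDiagonal_mem_archLocal_diagonal L N α w (z w)⟩ : archLocal L N (Matrix.diagonal α) w)
            (Subgroup.centralizer _) (fun _ hg => Subgroup.mem_centralizer_singleton_iff.1 hg) id)) =
      ((∏ w, c w : ℝ≥0) : ℝ) • classOrbitalIntegral m f (ConjClasses.mk (archDiagTorus L N α z)) := by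
  have hdm : ∀ w : {w : InfinitePlace L // IsComplex w}, Measurable
      (descConj (⟨circleDiagonal N (z w), circleDiagonal_mem_archLocal_diagonal L N α w (z w)⟩ : archLocal L N (Matrix.diagonal α) w)
        (Subgroup.centralizer _) (fun _ hg => Subgroup.mem_centralizer_singleton_iff.1 hg) (id : archLocal L N (Matrix.diagonal α) w → _)) :=
    fun w => (continuous_descConj _ _ _ continuous_id).measurable
  have hF : AEStronglyMeasurable (fun x : ∀ w : {w : InfinitePlace L // IsComplex w}, archLocal L N (Matrix.diagonal α) w => f ((archPiEquivCM N L (Matrix.diagonal α)).symm x))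
      ((Measure.pi fun w => quotientMeasure (Subgroup.centralizer _) (ρw w) (isClosed_coe_centralizer_singleton _) (νw w)).map
        (fun p w => descConj (⟨circleDiagonal N (z w), circleDiagonal_mem_archLocal_diagonal L N α w (z w)⟩ : archLocal L N (Matrix.diagonal α) w)
          (Subgroup.centralizer _) (fun _ hg => Subgroup.mem_centralizer_singleton_iff.1 hg) id (p w))) :=
    (hf.comp (archPiEquivCM N L (Matrix.diagonal α)).symm.continuous.measurable).aestronglyMeasurable
  rw [integral_pi_nnreal_smul_map _ _ hdm c _ hF,
    integral_pi_quotientMeasure_comp_conj_circleDiagonal_eq_classOrbitalIntegral_archDiagTorus_of_atPoint_eq L N α z νw ρw ρ hρ m ρ' hρ' hq f]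

end Literature.NumberTheory.Automorphic.UnitaryGroup

end
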